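import Summits.NavierStokesRegularity.NavierStokesRegularity.Theorems.ScenarioCensusLargeOrderRigidityP

/-!
# Scenario census, rows F13m / F13mL / F13dL — profile rigidity at diverging symmetry order:
# part 4/6: elementary geometry of `rotZ`, (S) selection of a power with displacement in a
# fixed window, small analysis helpers

Port of the ideator's tree-ready kit (ns-idea-9 g6, LINE 14 «dihedral_noswirl» REV 7 025308a3fa185027; kit file 1
`pub/ideators/ns-idea-9/lines/dihedral_noswirl/landing/ScenarioCensusLargeOrderRigidity.lean`, sha16 9e20ac97d4307bb6, 1417 l., its
declarations identical in REV 6/7; ref g7 PRE-CHECK ✓ §12.34, critic idea-crit-8 V56/V57/V58 PASS) by typer seat ns-census-typer-2 g8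
(lead g8 GO 2026-08-28T18:02Z; census FROZEN v1.62 — sub-row F13dL flips to TREE on port ACCEPT + ref CHECK), split for the
400-line rule into SIX modules `ScenarioCensusLargeOrderRigidity{Vocab, Statements, P, Geom, V}` → `ScenarioCensusLargeOrderRigidity`
(this last name is the kit's, so that kit file 2 `ScenarioCensusRowF13dLargeL3.lean` — ported by typer-1 g5 — imports it unchanged).
Declarations VERBATIM in the kit's namespace `…Theorems.ScenarioCensus.LargeOrderRigidity`; the only edits: the kit's
`local notation "ℝ³"` is replaced by the abbreviation `R3` (typer lint: no notation in ported files) and one-line docstrings are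
added to undocumented auxiliaries; the one-liner `abs_sin_sub_sin_le` is inlined as a `have` (dedup with an unrelated
Barriers lemma).

No census ROW value and no summit statement is proved in this file; `Row_F13mLarge` stays OPEN.
-/

noncomputable section

set_option linter.dupNamespace false
set_option linter.unusedVariables false

open Set Function Filter Topology MeasureTheory Metric TopologicalSpace
open scoped NNReal ENNReal RealInnerProductSpace

namespace Summit.NavierStokesRegularity.NavierStokesRegularity.Theorems.ScenarioCensus.LargeOrderRigidity

open Literature.Analysis Literature.Analysis.FluidPDE
open Summit.NavierStokesRegularity.NavierStokesRegularity.Theorems.ScenarioCensus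



/-! ### elementary geometry of `rotZ` (partly copied from LINE 12 «orbit_budget», same seat, PROVED there) -/

/-- Auxiliary step of LINE 14 «dihedral_noswirl» (`rotZ_map_sub`), ported verbatim. -/
theorem rotZ_map_sub (θ : ℝ) (x y : R3) : rotZ θ (x - y) = rotZ θ x - rotZ θ y := by
  simpa only [rotZLIE_apply] using map_sub (rotZLIE θ) x y

/-- Auxiliary step of LINE 14 «dihedral_noswirl» (`rotZ_map_add`), ported verbatim. -/
theorem rotZ_map_add (θ : ℝ) (x y : R3) : rotZ θ (x + y) = rotZ θ x + rotZ θ y := by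
  simpa only [rotZLIE_apply] using map_add (rotZLIE θ) x y

/-- Auxiliary step of LINE 14 «dihedral_noswirl» (`norm_sub_rotZ_sq`), ported verbatim. -/
theorem norm_sub_rotZ_sq (φ : ℝ) (a : R3) :
    ‖a - rotZ φ a‖ ^ 2 = 2 * (1 - Real.cos φ) * (a 0 ^ 2 + a 1 ^ 2) := by
  rw [EuclideanSpace.norm_eq, Real.sq_sqrt (Finset.sum_nonneg fun i _ => by positivity),
    Fin.sum_univ_three]
  simp only [PiLp.sub_apply, rotZ_apply_zero, rotZ_apply_one, rotZ_apply_two, Real.norm_eq_abs,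
    sq_abs, sub_self]
  linear_combination (a 0 ^ 2 + a 1 ^ 2) * Real.sin_sq_add_cos_sq φ

/-- Auxiliary step of LINE 14 «dihedral_noswirl» (`norm_sq_of_horizontal`), ported verbatim. -/
theorem norm_sq_of_horizontal {c : R3} (hc : c 2 = 0) : ‖c‖ ^ 2 = c 0 ^ 2 + c 1 ^ 2 := by
  rw [EuclideanSpace.norm_eq, Real.sq_sqrt (Finset.sum_nonneg fun i _ => by positivity),
    Fin.sum_univ_three]
  simp [Real.norm_eq_abs, sq_abs, hc]

/-- displacement of a rotation about a horizontal centre: `‖c − R_α c‖ = 2 ‖c‖ |sin(α/2)|`. -/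
theorem norm_sub_rotZ_eq {c : R3} (hc : c 2 = 0) (α : ℝ) :
    ‖c - rotZ α c‖ = 2 * ‖c‖ * |Real.sin (α / 2)| := by
  have h1 : ‖c - rotZ α c‖ ^ 2 = (2 * ‖c‖ * |Real.sin (α / 2)|) ^ 2 := by
    rw [norm_sub_rotZ_sq, ← norm_sq_of_horizontal hc, mul_pow, mul_pow, sq_abs, Real.sin_sq_eq_half_sub,
      show 2 * (α / 2) = α by ring]
    ring
  have h2 : 0 ≤ 2 * ‖c‖ * |Real.sin (α / 2)| := by positivity
  nlinarith [norm_nonneg (c - rotZ α c), sq_nonneg (‖c - rotZ α c‖ - 2 * ‖c‖ * |Real.sin (α / 2)|),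
    sq_nonneg (‖c - rotZ α c‖ + 2 * ‖c‖ * |Real.sin (α / 2)|)]

/-- rotations by angles `θ_j → 0` move each fixed point by `→ 0` (LINE 12). -/
theorem tendsto_rotZ_of_tendsto_zero {θ : ℕ → ℝ} (hθ : Tendsto θ atTop (𝓝 0)) (x : R3) :
    Tendsto (fun j => rotZ (θ j) x) atTop (𝓝 x) := by
  rw [tendsto_iff_norm_sub_tendsto_zero]
  have hsq : Tendsto (fun j => ‖x - rotZ (θ j) x‖ ^ 2) atTop (𝓝 0) := by
    have hcos : Tendsto (fun j => Real.cos (θ j)) atTop (𝓝 1) := by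
      have h := (Real.continuous_cos.tendsto 0).comp hθ
      rw [Real.cos_zero] at h
      exact h
    have : Tendsto (fun j => 2 * (1 - Real.cos (θ j)) * (x 0 ^ 2 + x 1 ^ 2)) atTop
        (𝓝 (2 * (1 - 1) * (x 0 ^ 2 + x 1 ^ 2))) :=
      ((hcos.const_sub 1).const_mul 2).mul_const _
    simp only [sub_self, mul_zero, zero_mul] at this
    exact this.congr fun j => (norm_sub_rotZ_sq (θ j) x).symm
  have h := hsq.sqrt
  simp only [Real.sqrt_zero] at h
  refine h.congr fun j => ?_
  rw [Real.sqrt_sq (norm_nonneg _), ← norm_neg, neg_sub]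

/-- joint continuity: `α_j → θ`, `c_j → ξ` ⇒ `R_{α_j} c_j → R_θ ξ`. -/
theorem tendsto_rotZ₂ {α : ℕ → ℝ} {θ : ℝ} {c : ℕ → R3} {ξ : R3} (hα : Tendsto α atTop (𝓝 θ))
    (hc : Tendsto c atTop (𝓝 ξ)) : Tendsto (fun j => rotZ (α j) (c j)) atTop (𝓝 (rotZ θ ξ)) := by
  rw [tendsto_iff_norm_sub_tendsto_zero]
  have hA : Tendsto (fun j => ‖c j - ξ‖) atTop (𝓝 0) := tendsto_iff_norm_sub_tendsto_zero.1 hc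
  have hB : Tendsto (fun j => ‖rotZ (α j - θ) ξ - ξ‖) atTop (𝓝 0) := by
    have h0 : Tendsto (fun j => α j - θ) atTop (𝓝 0) := by simpa using hα.sub_const θ
    exact tendsto_iff_norm_sub_tendsto_zero.1 (tendsto_rotZ_of_tendsto_zero h0 ξ)
  refine squeeze_zero (fun j => norm_nonneg _) (fun j => ?_) (by simpa using hA.add hB)
  have e1 : rotZ (α j) (c j) - rotZ θ ξ
      = rotZ (α j) (c j - ξ) + rotZ θ (rotZ (α j - θ) ξ - ξ) := by
    rw [rotZ_map_sub, rotZ_map_sub, ← rotZ_add, show θ + (α j - θ) = α j by ring]; abel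
  rw [e1]
  calc ‖rotZ (α j) (c j - ξ) + rotZ θ (rotZ (α j - θ) ξ - ξ)‖
      ≤ ‖rotZ (α j) (c j - ξ)‖ + ‖rotZ θ (rotZ (α j - θ) ξ - ξ)‖ := norm_add_le _ _
    _ = ‖c j - ξ‖ + ‖rotZ (α j - θ) ξ - ξ‖ := by rw [norm_rotZ, norm_rotZ]

/-- **(E) powers**: cyclic equivariance iterates to every power of the generator. -/
theorem IsCyclicEquivariantAbout.iterate {m : ℕ} {c : R3} {a : R3 → R3}
    (h : IsCyclicEquivariantAbout m c a) :
    ∀ (k : ℕ) (y : R3), a (c + rotZ ((k : ℝ) * (2 * Real.pi / m)) (y - c)) =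
      rotZ ((k : ℝ) * (2 * Real.pi / m)) (a y) := by
  intro k
  induction k with
  | zero => intro y; simp [rotZ_zero]
  | succ k ih =>
      intro y
      have e : ((k + 1 : ℕ) : ℝ) * (2 * Real.pi / m) =
          2 * Real.pi / m + (k : ℝ) * (2 * Real.pi / m) := by
        push_cast; ring
      have h1 := h (c + rotZ ((k : ℝ) * (2 * Real.pi / m)) (y - c))
      rw [add_sub_cancel_left, ih y] at h1
      rw [e, rotZ_add, rotZ_add]
      exact h1

/-- the affine form of an equivariance about a centre: `a (b + R y) = R (a y)` with `b = c − R c`. -/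
theorem affine_of_equivariant {c : R3} {a : R3 → R3} {α : ℝ}
    (h : ∀ y : R3, a (c + rotZ α (y - c)) = rotZ α (a y)) (y : R3) :
    a ((c - rotZ α c) + rotZLIE α y) = rotZLIE α (a y) := by
  have := h y
  rw [rotZ_map_sub] at this
  rw [rotZLIE_apply, rotZLIE_apply, ← this]
  congr 1
  abel

/-! ### (S) selection of a power with displacement in a fixed window -/

/-- discrete intermediate value step: a real sequence with `Q 0 < 1 ≤ Q n` crosses `1` somewhere. -/
theorem exists_first_crossing (Q : ℕ → ℝ) (h0 : Q 0 < 1) :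
    ∀ n : ℕ, 1 ≤ Q n → ∃ k : ℕ, 1 ≤ k ∧ k ≤ n ∧ Q (k - 1) < 1 ∧ 1 ≤ Q k := by
  intro n
  induction n with
  | zero => intro h; exact absurd h (not_le.2 h0)
  | succ n ih =>
      intro h
      by_cases hn : 1 ≤ Q n
      · obtain ⟨k, hk1, hkn, hlt, hle⟩ := ih hn
        exact ⟨k, hk1, hkn.trans (Nat.le_succ n), hlt, hle⟩
      · exact ⟨n + 1, Nat.succ_pos n, le_rfl, by simpa using not_le.1 hn, h⟩

/-- **(S)** for `s ≥ 2`, `m ≥ 2` and generator displacement `2 s sin(π/m) ≤ 1` there is a power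
`k`, `1 ≤ k ≤ m/2`, with displacement `2 s sin(πk/m) ∈ [1, 3]`. -/
theorem exists_power_window {s : ℝ} {m : ℕ} (hs : 2 ≤ s) (hm : 2 ≤ m)
    (hd : 2 * s * Real.sin (Real.pi / m) ≤ 1) :
    ∃ k : ℕ, 1 ≤ k ∧ 2 * k ≤ m ∧ 1 ≤ 2 * s * Real.sin (Real.pi * k / m) ∧
      2 * s * Real.sin (Real.pi * k / m) ≤ 3 := by
  have hπ := Real.pi_pos
  have hm0 : (0 : ℝ) < m := by exact_mod_cast (zero_lt_two.trans_le hm)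
  have hm2 : (2 : ℝ) ≤ m := by exact_mod_cast hm
  have hs0 : 0 < s := by linarith
  let Q : ℕ → ℝ := fun k => 2 * s * Real.sin (Real.pi * k / m)
  have hQ0 : Q 0 < 1 := by simp [Q]
  -- witness at `k₀ = m / 2`: the angle `π (m/2) / m` lies in `[π/4, π/2]`
  have hdiv : (m : ℝ) ≤ 2 * ((m / 2 : ℕ) : ℝ) + 1 := by
    have h := Nat.div_add_mod m 2
    have hmod : m % 2 ≤ 1 := Nat.lt_succ_iff.1 (Nat.mod_lt m two_pos)
    have h' : (m : ℝ) = 2 * ((m / 2 : ℕ) : ℝ) + ((m % 2 : ℕ) : ℝ) := by exact_mod_cast h.symm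
    have hmod' : ((m % 2 : ℕ) : ℝ) ≤ 1 := by exact_mod_cast hmod
    linarith
  have hdiv' : 2 * ((m / 2 : ℕ) : ℝ) ≤ m := by exact_mod_cast Nat.mul_div_le m 2
  have hlo : Real.pi / 4 ≤ Real.pi * (m / 2 : ℕ) / m := by
    rw [div_le_div_iff₀ (by norm_num : (0:ℝ) < 4) hm0]
    nlinarith
  have hhi : Real.pi * (m / 2 : ℕ) / m ≤ Real.pi / 2 := by
    rw [div_le_div_iff₀ hm0 (by norm_num : (0:ℝ) < 2)]
    nlinarith
  have hQk₀ : 1 ≤ Q (m / 2) := by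
    have hsin : Real.sqrt 2 / 2 ≤ Real.sin (Real.pi * (m / 2 : ℕ) / m) := by
      rw [← Real.sin_pi_div_four]
      exact Real.sin_le_sin_of_le_of_le_pi_div_two (by linarith) hhi hlo
    have hsqrt : (1 : ℝ) ≤ Real.sqrt 2 := Real.one_le_sqrt.2 (by norm_num)
    show 1 ≤ 2 * s * Real.sin (Real.pi * (m / 2 : ℕ) / m)
    nlinarith
  obtain ⟨k, hk1, hkle, hlt, hle⟩ := exists_first_crossing Q hQ0 (m / 2) hQk₀
  refine ⟨k, hk1, ?_, hle, ?_⟩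
  · have : k * 2 ≤ m := (Nat.le_div_iff_mul_le two_pos).1 hkle
    omega
  · -- one step changes the displacement by at most `2 s π / m ≤ π / 2 < 2`
    have hstep : |Real.sin (Real.pi * k / m) - Real.sin (Real.pi * (k - 1 : ℕ) / m)| ≤ Real.pi / m := by
      have abs_sin_sub_sin_le : ∀ a b : ℝ, |Real.sin a - Real.sin b| ≤ |a - b| := fun a b => by
        rw [Real.sin_sub_sin, abs_mul, abs_mul, abs_two]
        have h1 : |Real.sin ((a - b) / 2)| ≤ |(a - b) / 2| := Real.abs_sin_le_abs
        have h2 : |Real.cos ((a + b) / 2)| ≤ 1 := Real.abs_cos_le_one _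
        have h3 : |(a - b) / 2| = |a - b| / 2 := by rw [abs_div, abs_two]
        rw [h3] at h1
        nlinarith [abs_nonneg (Real.sin ((a - b) / 2)), abs_nonneg (Real.cos ((a + b) / 2)),
          abs_nonneg (a - b)]
      refine (abs_sin_sub_sin_le _ _).trans ?_
      have : Real.pi * k / m - Real.pi * (k - 1 : ℕ) / m = Real.pi / m := by
        have hk1' : ((k - 1 : ℕ) : ℝ) = k - 1 := by
          rw [Nat.cast_sub hk1]; simp
        rw [hk1']; field_simp; ring
      rw [this, abs_of_pos (div_pos hπ hm0)]
    -- Jordan: `sin (π/m) ≥ (2/π)(π/m) = 2/m`, so `4 s / m ≤ 2 s sin(π/m) ≤ 1`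
    have hjordan : 2 / Real.pi * (Real.pi / m) ≤ Real.sin (Real.pi / m) :=
      Real.mul_le_sin (by positivity) (by
        rw [div_le_div_iff₀ hm0 (by norm_num : (0:ℝ) < 2)]
        nlinarith)
    have h1 : 2 / Real.pi * (Real.pi / m) = 2 / m := by field_simp
    rw [h1] at hjordan
    have h2 : 2 * s * (2 / m) ≤ 1 := by nlinarith
    have hsm : 2 * s * (Real.pi / m) ≤ Real.pi / 2 := by
      have h3 : 2 * s * (Real.pi / m) = (2 * s * (2 / m)) * (Real.pi / 2) := by ring
      rw [h3]
      nlinarith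
    have habs := (abs_sub_le_iff.1 hstep).1
    have hπ4 : Real.pi < 4 := Real.pi_lt_four
    have hlt' : 2 * s * Real.sin (Real.pi * (k - 1 : ℕ) / m) < 1 := hlt
    show 2 * s * Real.sin (Real.pi * k / m) ≤ 3
    nlinarith

/-! ### small analysis helpers -/

/-- periodicity: the rotation only depends on the angle modulo `2π`. -/
theorem rotZ_sub_int_mul_two_pi (θ : ℝ) (n : ℤ) (x : R3) :
    rotZ (θ - n * (2 * Real.pi)) x = rotZ θ x := by
  ext i
  fin_cases i <;> simp [Real.cos_sub_int_mul_two_pi, Real.sin_sub_int_mul_two_pi]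

/-- `¬ (u → +∞)` along `atTop` ⇒ `u ≤ R` frequently, for some `R`. -/
theorem exists_frequently_le_of_not_tendsto {u : ℕ → ℝ} (h : ¬ Tendsto u atTop atTop) :
    ∃ R : ℝ, ∃ᶠ j in atTop, u j ≤ R := by
  obtain ⟨S, hS, hfr⟩ := Filter.not_tendsto_iff_exists_frequently_notMem.1 h
  obtain ⟨R, hR⟩ := mem_atTop_sets.1 hS
  exact ⟨R, hfr.mono fun j hj => (not_le.1 fun hle => hj (hR _ hle)).le⟩

/-- limits of horizontal vectors are horizontal. -/
theorem horizontal_of_tendsto {c : ℕ → R3} {ξ : R3} (hc : ∀ j, c j 2 = 0) (h : Tendsto c atTop (𝓝 ξ)) :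
    ξ 2 = 0 := by
  have h2 : Tendsto (fun j => (EuclideanSpace.proj (2 : Fin 3) : R3 →L[ℝ] ℝ) (c j)) atTop
      (𝓝 ((EuclideanSpace.proj (2 : Fin 3) : R3 →L[ℝ] ℝ) ξ)) :=
    ((EuclideanSpace.proj (2 : Fin 3) : R3 →L[ℝ] ℝ).continuous.tendsto ξ).comp h
  have e : ∀ v : R3, (EuclideanSpace.proj (2 : Fin 3) : R3 →L[ℝ] ℝ) v = v 2 := fun v => rfl
  simp only [e, hc] at h2
  exact (tendsto_nhds_unique h2 tendsto_const_nhds)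

/-- **(D)**, natural powers: if `m_j → ∞` then every angle `θ ≥ 0` is a limit of lattice angles
`k_j · (2π / m_j)` with `k_j ∈ ℕ`. -/
theorem exists_nat_seq_tendsto_angle {m : ℕ → ℕ} (hm : Tendsto m atTop atTop) {θ : ℝ} (hθ : 0 ≤ θ) :
    ∃ k : ℕ → ℕ, Tendsto (fun j => (k j : ℝ) * (2 * Real.pi / (m j : ℝ))) atTop (𝓝 θ) := by
  refine ⟨fun j => ⌊θ * (m j : ℝ) / (2 * Real.pi)⌋₊, ?_⟩
  have hπ : 0 < 2 * Real.pi := by positivity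
  have hm' : Tendsto (fun j => (m j : ℝ)) atTop atTop := tendsto_natCast_atTop_atTop.comp hm
  have hinv : Tendsto (fun j => 2 * Real.pi / (m j : ℝ)) atTop (𝓝 0) :=
    tendsto_const_nhds.div_atTop hm'
  have hlow : Tendsto (fun j => θ - 2 * Real.pi / (m j : ℝ)) atTop (𝓝 θ) := by
    simpa using tendsto_const_nhds.sub hinv
  refine tendsto_of_tendsto_of_tendsto_of_le_of_le' hlow tendsto_const_nhds ?_ ?_
  · filter_upwards [hm'.eventually_gt_atTop 0] with j hj
    have hx : 0 ≤ θ * (m j : ℝ) / (2 * Real.pi) := by positivity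
    have h1 : θ * (m j : ℝ) / (2 * Real.pi) - 1 < (⌊θ * (m j : ℝ) / (2 * Real.pi)⌋₊ : ℝ) := by
      have := Nat.lt_floor_add_one (θ * (m j : ℝ) / (2 * Real.pi))
      linarith
    have h1' := (mul_lt_mul_of_pos_right h1 (div_pos hπ hj))
    have e1 : (θ * (m j : ℝ) / (2 * Real.pi) - 1) * (2 * Real.pi / (m j : ℝ))
        = θ - 2 * Real.pi / (m j : ℝ) := by
      field_simp
    rw [e1] at h1'
    exact h1'.le
  · filter_upwards [hm'.eventually_gt_atTop 0] with j hj
    have hx : 0 ≤ θ * (m j : ℝ) / (2 * Real.pi) := by positivity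
    have h2 : (⌊θ * (m j : ℝ) / (2 * Real.pi)⌋₊ : ℝ) ≤ θ * (m j : ℝ) / (2 * Real.pi) := Nat.floor_le hx
    have h2' := mul_le_mul_of_nonneg_right h2 (div_pos hπ hj).le
    have e1 : θ * (m j : ℝ) / (2 * Real.pi) * (2 * Real.pi / (m j : ℝ)) = θ := by
      field_simp
    rw [e1] at h2'
    exact h2'

end Summit.NavierStokesRegularity.NavierStokesRegularity.Theorems.ScenarioCensus.LargeOrderRigidity

end
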